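import Mathlib
import Summits.NavierStokesRegularity.NavierStokesRegularity.Theorems.EulerZoomLiouvillePowerGaugeEulerLiouvilleSupercriticalModulationPast
import HarnessLib

/-!
# Crux `EulerZoomLiouville.PowerGaugeEulerLiouville` (stmt-NavierStokesRegularity-19832), stub `stub_nonSelfSimilarRest`:
# steady field plus a fixed field with OSCILLATING super-critical modulation (limsup form) is trivial

Helper file (theorems only; `--supports stmt-NavierStokesRegularity-19832`; def-free).  Hand leafhand-ns-eulerzoomliouville-11 g0;
sequel to `…SupercriticalModulationPast` (which needs `|θ(τ)|/|τ|^{(1−2ρ)/4} → ∞`).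

THE STRATUM.  `u(τ, x) = U₀(x) + θ(τ) U₁(x)` for a.e. `(τ, x) ∈ (−∞, T₁) × ℝ³` (`T₁ ≤ 0`, `U₀, U₁` arbitrary) with a CONTINUOUS modulation
`θ` that is super-critical only along SOME sequence of past times — `limsup_{τ → −∞} |θ(τ)|/|τ|^{(1−2ρ)/4} = ∞`, written as
`∀ M τ₀, ∃ τ ≤ τ₀, M |τ|^{(1−2ρ)/4} < |θ(τ)|` — is trivial (`OscModulatedPast.ae_eq_zero_of_gauge_of_aeOscModulatedPast`, binder
`Birth.nonSelfSimilar_of_aeOscModulatedPast`, window `0 < ρ ≤ ½`).  Examples NOT covered by the `→ ∞` version: `θ(τ) = |τ|^β sin τ`,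
`|τ|^β sin(log |τ|)` (`β > (1−2ρ)/4`), and any continuous `θ` with super-critical peaks separated by arbitrarily long quiet stretches.

PROOF.  As in `…SupercriticalModulationPast`, but the scale `a` is ADAPTED to a peak: pick `τ⋆ ≤ τ₀` with `(M+1)|τ⋆|^e < |θ(τ⋆)|`, put
`a² = (4/3)|τ⋆|` (so `τ⋆ ∈ (−a², −a²/2)`), and use continuity of `θ` at `τ⋆` to find a GOOD slice `τ₁` next to `τ⋆` inside the
window with `|θ(τ₁)| ≥ M|τ⋆|^e`; then `ModulatedPast.gap_sq_lower` / `lintegral_le_of_gap` give `∫_{B_R}|U₁|² ≤ 32c/M²`.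

WHAT THIS IS NOT: not a proof of the stub or of the crux; nothing about Navier–Stokes. [folklore]
-/

noncomputable section

-- flat `Theorems/<Route><Decl>…` files of one crux share the namespace of the crux (tree convention)
set_option linter.dupNamespace false

open MeasureTheory Set Filter Topology Metric Function TopologicalSpace
open scoped RealInnerProductSpace NNReal ENNReal

namespace Summit.NavierStokesRegularity.NavierStokesRegularity.Theorems.PowerGaugeEulerLiouville

open Literature.Analysis Literature.Analysis.FunctionSpaces Literature.Analysis.FluidPDE

namespace OscModulatedPast

/-- **MEMBERS `U₀(x) + θ(τ) U₁(x)` WITH CONTINUOUS, LIMSUP-SUPER-CRITICAL MODULATION ARE TRIVIAL** (`0 < ρ ≤ ½`). [folklore] -/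
theorem ae_eq_zero_of_gauge_of_aeOscModulatedPast {ρ : ℝ} (hρ : 0 < ρ) (hρh : ρ ≤ 1 / 2)
    {u : ℝ → EuclideanSpace ℝ (Fin 3) → EuclideanSpace ℝ (Fin 3)} {p : ℝ → EuclideanSpace ℝ (Fin 3) → ℝ}
    {H : ℝ → EuclideanSpace ℝ (Fin 3) → EuclideanSpace ℝ (Fin 3) →L[ℝ] EuclideanSpace ℝ (Fin 3)} {c : ℝ≥0}
    (hsw : IsSuitableWeakSolutionOn (slab (EuclideanSpace ℝ (Fin 3)) (Iio 0) isOpen_Iio) 0 0 u p)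
    (hH : HasWeakSpatialGradientOn (slab (EuclideanSpace ℝ (Fin 3)) (Iio 0) isOpen_Iio) u H)
    (hc : ∀ a : ℝ, 0 < a → ENNReal.ofReal (a ^ (2 * ρ)) * cknA a (0 : ℝ × EuclideanSpace ℝ (Fin 3)) u +
        ENNReal.ofReal (a ^ ρ) * cknE a (0 : ℝ × EuclideanSpace ℝ (Fin 3)) H +
        ENNReal.ofReal (a ^ (2 * ρ)) * cknD a (0 : ℝ × EuclideanSpace ℝ (Fin 3)) p ≤ (c : ℝ≥0∞))
    {T₁ : ℝ} (hT₁ : T₁ ≤ 0) {θ : ℝ → ℝ} {U₀ U₁ : EuclideanSpace ℝ (Fin 3) → EuclideanSpace ℝ (Fin 3)}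
    (hθc : Continuous θ)
    (hθ : ∀ M τ₀ : ℝ, ∃ τ, τ ≤ τ₀ ∧ M * |τ| ^ ((1 - 2 * ρ) / 4) < |θ τ|)
    (hU : ∀ᵐ z ∂(volume.restrict (Iio T₁ ×ˢ (univ : Set (EuclideanSpace ℝ (Fin 3))))),
      u z.1 z.2 = U₀ z.2 + θ z.1 • U₁ z.2) :
    uncurry u =ᵐ[volume.restrict (Iio (0 : ℝ) ×ˢ (univ : Set (EuclideanSpace ℝ (Fin 3))))] 0 := by
  set e : ℝ := (1 - 2 * ρ) / 4 with he
  have he0 : 0 ≤ e := by rw [he]; linarith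
  have he1 : 2 * e ≤ 1 := by rw [he]; linarith
  -- (1) good slices
  have hgood : ∀ᵐ τ ∂(volume.restrict (Iio T₁)),
      LocallyIntegrable (u τ) volume ∧ ∀ᵐ x ∂(volume : Measure (EuclideanSpace ℝ (Fin 3))), u τ x = U₀ x + θ τ • U₁ x := by
    filter_upwards [FrameSteady.ae_hasWeakFDerivOn_slice_past hH hT₁,
      AffinePast.ae_ae_of_ae_slab (P := fun τ x => u τ x = U₀ x + θ τ • U₁ x) hU] with τ hτ hτ'
    exact ⟨locallyIntegrableOn_univ.1 (by simpa only [Opens.coe_top] using hτ.locallyIntegrableOn), hτ'⟩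
  have hA : ∀ a : ℝ, 0 < a →
      ENNReal.ofReal (a ^ (2 * ρ)) * cknA a (0 : ℝ × EuclideanSpace ℝ (Fin 3)) u ≤ (c : ℝ≥0∞) :=
    fun a ha => le_trans (le_add_right (le_add_right le_rfl)) (hc a ha)
  -- (2) one good reference slice `τ₂ ∈ (T₁ − 1, T₁)`
  have hwin₂ : volume (Ioo (T₁ - 1) T₁) ≠ 0 := by
    rw [Real.volume_Ioo]; exact (ENNReal.ofReal_pos.2 (by linarith)).ne'
  obtain ⟨τ₂, hτ₂, hgood₂⟩ := Measure.exists_mem_of_measure_ne_zero_of_ae hwin₂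
    (ae_restrict_of_ae_restrict_of_subset (fun τ hτ => hτ.2) hgood)
  have hm₂ : AEStronglyMeasurable (fun x => U₀ x + θ τ₂ • U₁ x) volume :=
    hgood₂.1.aestronglyMeasurable.congr hgood₂.2
  set B : ℝ := |θ τ₂| with hB
  -- (3) for every `M ≥ 2B + 1` and every `R > 0`: `∫_{B_R} |U₁|² ≤ 32 c / M²`
  have hstep : ∀ M : ℝ, 2 * B + 1 ≤ M → ∀ R : ℝ, 0 < R →
      AEStronglyMeasurable U₁ volume ∧
      ∫⁻ x in ball (0 : EuclideanSpace ℝ (Fin 3)) R, ‖U₁ x‖ₑ ^ 2 ≤ ENNReal.ofReal (32 * (c : ℝ) / M ^ 2) := by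
    intro M hM R hR
    have hMpos : 0 < M := by have : 0 ≤ B := abs_nonneg _; linarith
    -- a peak `τ⋆` far in the past
    obtain ⟨τs, hτs, hpeak⟩ := hθ (M + 1) (min (-(R ^ 2)) (-(3 * (1 - T₁))))
    have hτsR : τs ≤ -(R ^ 2) := le_trans hτs (min_le_left _ _)
    have hτsT : τs ≤ -(3 * (1 - T₁)) := le_trans hτs (min_le_right _ _)
    have hR2 : 0 < R ^ 2 := by positivity
    have hτsneg : τs < 0 := by linarith
    have habsτs : |τs| = -τs := abs_of_neg hτsneg
    -- the adapted scale `a² = (4/3)|τ⋆|`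
    set a : ℝ := Real.sqrt (4 / 3 * |τs|) with ha_def
    have h43 : 0 ≤ 4 / 3 * |τs| := by positivity
    have ha2 : a ^ 2 = 4 / 3 * |τs| := Real.sq_sqrt h43
    have hapos : 0 < a := Real.sqrt_pos.2 (by rw [habsτs]; linarith)
    have haR : R ≤ a := by
      rw [ha_def, Real.le_sqrt hR.le h43, habsτs]; linarith
    have ha1 : 4 * (1 - T₁) ≤ a ^ 2 := by rw [ha2, habsτs]; linarith
    have hwinτs : τs ∈ Ioo (-(a ^ 2)) (-(a ^ 2) / 2) := by
      rw [ha2, habsτs]; constructor <;> linarith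
    -- continuity of `θ` at the peak: a window around `τ⋆` where `|θ| > |θ τ⋆| − 1`
    obtain ⟨δ, hδ, hcont⟩ := Metric.continuousAt_iff.1 hθc.continuousAt 1 one_pos
    set lo : ℝ := max (-(a ^ 2)) (τs - δ) with hlo
    set hi : ℝ := min (-(a ^ 2) / 2) (τs + δ) with hhi
    have hlo_lt : lo < τs := max_lt hwinτs.1 (by linarith)
    have hhi_gt : τs < hi := lt_min hwinτs.2 (by linarith)
    have hwin₁ : volume (Ioo lo hi) ≠ 0 := by
      rw [Real.volume_Ioo]; exact (ENNReal.ofReal_pos.2 (by linarith)).ne'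
    have hsub₁ : Ioo lo hi ⊆ Iio T₁ := fun τ hτ => by
      simp only [mem_Iio]
      have h1 : τ < -(a ^ 2) / 2 := lt_of_lt_of_le hτ.2 (min_le_left _ _)
      linarith
    obtain ⟨τ₁, hτ₁, hgood₁⟩ :=
      Measure.exists_mem_of_measure_ne_zero_of_ae hwin₁ (ae_restrict_of_ae_restrict_of_subset hsub₁ hgood)
    have hτ₁lo : -(a ^ 2) < τ₁ := lt_of_le_of_lt (le_max_left _ _) hτ₁.1
    have hτ₁hi : τ₁ < -(a ^ 2) / 2 := lt_of_lt_of_le hτ₁.2 (min_le_left _ _)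
    have hτ₁δ : dist τ₁ τs < δ := by
      rw [Real.dist_eq, abs_lt]
      have h1 : τs - δ < τ₁ := lt_of_le_of_lt (le_max_right _ _) hτ₁.1
      have h2 : τ₁ < τs + δ := lt_of_lt_of_le hτ₁.2 (min_le_right _ _)
      constructor <;> linarith
    have hθnear : |θ τs| - 1 < |θ τ₁| := by
      have h := hcont hτ₁δ
      rw [Real.dist_eq] at h
      have := abs_sub_abs_le_abs_sub (θ τs) (θ τ₁)
      rw [abs_sub_comm] at h
      linarith
    have hm₁ : AEStronglyMeasurable (fun x => U₀ x + θ τ₁ • U₁ x) volume :=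
      hgood₁.1.aestronglyMeasurable.congr hgood₁.2
    -- the gap, measured at the peak scale
    have habs : a ^ 2 / 2 ≤ |τs| := by rw [ha2]; linarith [abs_nonneg τs]
    have hone : 1 ≤ a ^ 2 / 2 := by linarith
    have hpow1 : 1 ≤ |τs| ^ e := Real.one_le_rpow (le_trans hone habs) he0
    have hθ₁ : M * |τs| ^ e ≤ |θ τ₁| := by
      have h1 : (M + 1) * |τs| ^ e = M * |τs| ^ e + |τs| ^ e := by ring
      linarith
    have hθ₂ : |θ τ₂| ≤ M / 2 := by rw [← hB]; linarith
    have hgap2 : M ^ 2 / 8 * a ^ (1 - 2 * ρ) ≤ (θ τ₂ - θ τ₁) ^ 2 := by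
      have h5 : a ^ (2 * (2 * e)) = a ^ (1 - 2 * ρ) := by rw [he]; ring_nf
      rw [← h5]
      exact ModulatedPast.gap_sq_lower hapos he0 he1 hMpos.le habs hone hθ₁ hθ₂
    -- slice bounds and the two-slice estimate
    have ha2pos : 0 < a ^ 2 := by positivity
    have hτ₁neg : τ₁ < 0 := by linarith
    have hwinτ₁ : τ₁ ∈ Ioo (-(a ^ 2)) 0 := ⟨hτ₁lo, hτ₁neg⟩
    have hwinτ₂ : τ₂ ∈ Ioo (-(a ^ 2)) 0 := ⟨by have := hτ₂.1; linarith, lt_of_lt_of_le hτ₂.2 hT₁⟩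
    have hb₁ : ∫⁻ x in ball (0 : EuclideanSpace ℝ (Fin 3)) a, ‖U₀ x + θ τ₁ • U₁ x‖ₑ ^ 2 ≤
        ENNReal.ofReal ((c : ℝ) * a ^ (1 - 2 * ρ)) := by
      refine le_of_eq_of_le ?_ (Backward.lintegral_ball_le_of_gaugeA hapos (hA a hapos) hwinτ₁)
      refine lintegral_congr_ae (ae_restrict_of_ae ?_)
      filter_upwards [hgood₁.2] with x hx
      rw [hx]
    have hb₂ : ∫⁻ x in ball (0 : EuclideanSpace ℝ (Fin 3)) a, ‖U₀ x + θ τ₂ • U₁ x‖ₑ ^ 2 ≤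
        ENNReal.ofReal ((c : ℝ) * a ^ (1 - 2 * ρ)) := by
      refine le_of_eq_of_le ?_ (Backward.lintegral_ball_le_of_gaugeA hapos (hA a hapos) hwinτ₂)
      refine lintegral_congr_ae (ae_restrict_of_ae ?_)
      filter_upwards [hgood₂.2] with x hx
      rw [hx]
    have hYpos : 0 < M ^ 2 / 8 * a ^ (1 - 2 * ρ) := by
      have := Real.rpow_pos_of_pos hapos (1 - 2 * ρ); positivity
    have hne : θ τ₂ - θ τ₁ ≠ 0 := by
      intro h0
      rw [h0] at hgap2
      norm_num at hgap2
      linarith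
    have hU₁meas : AEStronglyMeasurable U₁ volume := by
      have eU : U₁ = (θ τ₂ - θ τ₁)⁻¹ • ((fun x => U₀ x + θ τ₂ • U₁ x) - fun x => U₀ x + θ τ₁ • U₁ x) := by
        funext x
        simp only [Pi.smul_apply, Pi.sub_apply]
        rw [add_sub_add_left_eq_sub, ← sub_smul, smul_smul, inv_mul_cancel₀ hne, one_smul]
      rw [eU]
      exact (hm₂.sub hm₁).const_smul _
    refine ⟨hU₁meas, ?_⟩
    have hkey := AffinePast.lintegral_coeff_le_of_two_slices
      (μ := volume.restrict (ball (0 : EuclideanSpace ℝ (Fin 3)) a)) hm₂.restrict hb₁ hb₂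
    have hgap' : ENNReal.ofReal (M ^ 2 / 8 * a ^ (1 - 2 * ρ)) ≤ ‖θ τ₂ - θ τ₁‖ₑ ^ 2 := by
      rw [Real.enorm_eq_ofReal_abs, ← ENNReal.ofReal_pow (abs_nonneg _), sq_abs]
      exact ENNReal.ofReal_le_ofReal hgap2
    have h2 := ModulatedPast.lintegral_le_of_gap hYpos hgap' hkey
    refine le_trans (lintegral_mono_set (ball_subset_ball haR)) (le_trans h2 (le_of_eq ?_))
    congr 1
    have hane : a ^ (1 - 2 * ρ) ≠ 0 := (Real.rpow_pos_of_pos hapos _).ne'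
    field_simp
    ring
  -- (4) `U₁ = 0` a.e.
  have hU₁meas : AEStronglyMeasurable U₁ volume :=
    (hstep (2 * B + 1) le_rfl 1 one_pos).1
  have hball : ∀ R : ℝ, 0 < R → ∫⁻ x in ball (0 : EuclideanSpace ℝ (Fin 3)) R, ‖U₁ x‖ₑ ^ 2 = 0 := by
    intro R hR
    refine nonpos_iff_eq_zero.1 ?_
    have hlim : Tendsto (fun M : ℝ => ENNReal.ofReal (32 * (c : ℝ) / M ^ 2)) atTop (𝓝 0) := by
      rw [show (0 : ℝ≥0∞) = ENNReal.ofReal 0 by simp]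
      exact ENNReal.tendsto_ofReal (Tendsto.div_atTop tendsto_const_nhds (tendsto_pow_atTop two_ne_zero))
    refine ge_of_tendsto hlim ?_
    filter_upwards [eventually_ge_atTop (2 * B + 1)] with M hM
    exact (hstep M hM R hR).2
  have hU₁zero : ∀ᵐ x ∂(volume : Measure (EuclideanSpace ℝ (Fin 3))), U₁ x = 0 := by
    have hballae : ∀ n : ℕ, ∀ᵐ x ∂(volume.restrict (ball (0 : EuclideanSpace ℝ (Fin 3)) ((n : ℝ) + 1))), U₁ x = 0 := by
      intro n
      have h0 := hball ((n : ℝ) + 1) (by positivity)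
      have h1 := (lintegral_eq_zero_iff' (hU₁meas.restrict.enorm.pow_const 2)).1 h0
      filter_upwards [h1] with x hx
      simpa using hx
    have h := (ae_restrict_iUnion_iff (μ := (volume : Measure (EuclideanSpace ℝ (Fin 3))))
      (fun n : ℕ => ball (0 : EuclideanSpace ℝ (Fin 3)) ((n : ℝ) + 1)) (fun x => U₁ x = 0)).2 hballae
    rwa [iUnion_ball_nat_succ, Measure.restrict_univ] at h
  -- (5) a.e. steady in the past
  have hU' : ∀ᵐ z ∂(volume.restrict (Iio T₁ ×ˢ (univ : Set (EuclideanSpace ℝ (Fin 3))))), u z.1 z.2 = U₀ z.2 := by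
    filter_upwards [hU, AffinePast.ae_slab_of_ae (T₁ := T₁) hU₁zero] with z hz hz0
    rw [hz, hz0, smul_zero, add_zero]
  exact AePastSteady.ae_eq_zero_of_gauge_of_aePastSteady hρ hsw hH hc hT₁ hU'

end OscModulatedPast

/-! ## Binder language (`Birth.InClass`), window `0 < ρ ≤ ½` of `stub_nonSelfSimilarRest` -/

/-- **Binder language: STEADY FIELD + FIXED FIELD WITH CONTINUOUS LIMSUP-SUPER-CRITICAL MODULATION ⇒ TRIVIAL** —
`u(τ, x) = U₀(x) + θ(τ) U₁(x)` for a.e. `(τ, x) ∈ (−∞,T₁) × ℝ³`, some `T₁ ≤ 0`, `U₀ U₁` arbitrary, `θ` CONTINUOUS with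
`limsup_{τ→−∞} |θ(τ)|/|τ|^{(1−2ρ)/4} = ∞` (`∀ M τ₀, ∃ τ ≤ τ₀, M|τ|^{(1−2ρ)/4} < |θ(τ)|`; e.g. `θ = |τ|^β sin τ`, `β > (1−2ρ)/4`) ⇒
`u = 0` a.e., in the window `0 < ρ ≤ ½` (`OscModulatedPast.ae_eq_zero_of_gauge_of_aeOscModulatedPast`). [folklore] -/
theorem Birth.nonSelfSimilar_of_aeOscModulatedPast :
    ∀ ρ : ℝ, 0 < ρ → ρ ≤ 1 / 2 →
      ∀ (u : ℝ → EuclideanSpace ℝ (Fin 3) → EuclideanSpace ℝ (Fin 3)) (p : ℝ → EuclideanSpace ℝ (Fin 3) → ℝ)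
        (H : ℝ → EuclideanSpace ℝ (Fin 3) → EuclideanSpace ℝ (Fin 3) →L[ℝ] EuclideanSpace ℝ (Fin 3)) (c : ℝ≥0),
        Birth.InClass ρ u p H c →
          (∃ T₁ : ℝ, T₁ ≤ 0 ∧ ∃ θ : ℝ → ℝ, ∃ U₀ U₁ : EuclideanSpace ℝ (Fin 3) → EuclideanSpace ℝ (Fin 3),
              Continuous θ ∧ (∀ M τ₀ : ℝ, ∃ τ, τ ≤ τ₀ ∧ M * |τ| ^ ((1 - 2 * ρ) / 4) < |θ τ|) ∧
              ∀ᵐ z ∂(volume.restrict (Iio T₁ ×ˢ (univ : Set (EuclideanSpace ℝ (Fin 3))))),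
                u z.1 z.2 = U₀ z.2 + θ z.1 • U₁ z.2) →
          uncurry u =ᵐ[volume.restrict (Iio (0 : ℝ) ×ˢ (univ : Set (EuclideanSpace ℝ (Fin 3))))] 0 := by
  intro ρ hρ hρh u p H c hcl h
  obtain ⟨T₁, hT₁, θ, U₀, U₁, hθc, hθ, hU⟩ := h
  exact OscModulatedPast.ae_eq_zero_of_gauge_of_aeOscModulatedPast hρ hρh hcl.1 hcl.2.1 hcl.2.2 hT₁ hθc hθ hU

end Summit.NavierStokesRegularity.NavierStokesRegularity.Theorems.PowerGaugeEulerLiouville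

end
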